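import Summits.BirchSwinnertonDyer.BirchSwinnertonDyer.Theorems.GenusKolyvaginAtTwoShaCardDvdPowAtTwoPosTSupplyRealShift
import Summits.BirchSwinnertonDyer.BirchSwinnertonDyer.Theorems.GenusKolyvaginAtTwoGenusPrimitiveSupplyAtTwoPrimeHeegnerTwinSilentPrimes
import Literature.NumberTheory.EllipticCurves.GlobalMinimalModelProofs
import Literature.NumberTheory.EllipticCurves.LFunctionSmulProofs
import Summits.BirchSwinnertonDyer.BirchSwinnertonDyer.Theorems.GenusKolyvaginAtTwoGenusPrimitiveSupplyAtTwoOfKernels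
import Summits.BirchSwinnertonDyer.BirchSwinnertonDyer.Theses.GenusKolyvaginAtTwo
import HarnessLib

/-!
# Route `GenusKolyvaginAtTwo`, crux supply⁺ `GenusPrimitiveSupplyAtTwoPosDiscShallow` (stmt-BirchSwinnertonDyer-25504, `Δ > 0`), LEAD skeleton
# «genus_supply_pos_shallow»: stub A⁺ `stub_minimalTwinSupplyAtTwoPos` REDUCED TO ITS ANALYTIC (PRIME) KERNEL, and THE CRUX BY NAME FROM ITS TWO
# OPEN KERNELS modulo Gross–Zagier (the `Δ > 0` twin of `…GenusPrimitiveSupplyAtTwoOfKernels`)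

Seat `bsd-line-gk2-p3` g27 (PROVER seat 3/3, cell `bsd-f1-sign2`), `--supports stmt-BirchSwinnertonDyer-25504` (helper; closes nothing; the stub
itself is NOT proved — its analytic kernel is displayed as the hypothesis `hA`).  THEOREMS ONLY (no definition, no named fact, no `sorry`); standard
axioms.  BSD is NOT proved by any of this; the supply crux is NOT proved.

WHAT.  LEAD gk2-p1 g20's `…PosTSupplyRealShift` (p755596: the real-place shift law with its decider, `#Sel₂ = 1 ⟹ #Sel₂(Wd) = 2`, necessity of the
real-place clause) and this seat's `…PosTOnCutRankQ` §4 (p759730: every prime of `d_K` silent ⟹ `ord₂ C(Wd) = 0`) combined in the currency of the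
registered stub:
* §1 `natCard_selmerGroup_twin_eq_two_of_realNarrow_of_padicValNat_eq_zero` — the REAL-NARROW clause of the crux VERBATIM
  (`#Sel₂(W) = 1 ∨ (#Sel₂(W) = 4 ∧ ∃ c ∈ Sel₂(W), loc_∞ c ≠ 0)`) ⟹ `#Sel₂(Wd) = 2` for every Tamagawa-odd Heegner twin on `Δ > 0`;
  `twin_padicValNat_eq_zero_and_natCard_selmerGroup_eq_two_of_realNarrow_of_forall_silent` — the same in the all-silent currency
  (`W(ℚ_q)[2] = 0` at every `q ∣ d_K` ⟹ `ord₂ C(Wd) = 0 ∧ #Sel₂(Wd) = 2`).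
* §2 `exists_isGloballyMinimal_twin_of_realNarrow_of_forall_silent` — with `r_an(W^(d_K)) = 1` displayed: a globally minimal model `Wd ≅ W^(d_K)` with
  `r_an(Wd) = 1 ∧ #Sel₂(Wd) = 2 ∧ ord₂ C(Wd) = 0` (global minimal model over `ℚ`, `analyticRank_smul`) — the twin block of the stub.
* §4 `exists_allSilent_heegnerField_twin_of_realNarrow` — UNCONDITIONALLY, beyond every bound: a silent prime Heegner field `K = ℚ(√−ℓ)`
  (gk2-p5's Čebotarev supply `GenusKolyTwin.exists_silent_prime_heegnerField`: odd `d_K = −ℓ ≠ −3`, Heegner, the two non-squares, `ℓ` silent)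
  for which EVERY elliptic model `Wd ≅ W^(d_K)` has `ord₂ C(Wd) = 0 ∧ #Sel₂(Wd) = 2` — everything stub A⁺ asks except `r_an(Wd) = 1`;
  **`stub_minimalTwinSupplyAtTwoPos_of_primeKernel`** — stub A⁺ from the PRIME kernel «some silent admissible prime `ℓ` has `r_an(W^(−ℓ)) = 1»`.
* §5 **`genusPrimitiveSupplyAtTwoPosDiscShallow_of_kernels : hGZ → hP → hC → GenusPrimitiveSupplyAtTwoPosDiscShallow`** BY NAME — LEAD's composition with
  stub A⁺ := §4's `_of_primeKernel`, stub B := gk2-p4's `GenusKoly.stub_heegnerNonTorsionAtTwo_of_grossZagier` (named fact `gross_zagier`), stub C⁺ := `hC`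
  VERBATIM (2-primitivity at transposition-deep Kolyvagin primes, beyond print): crux 25504 is OPEN EXACTLY at (hP) ∧ (C⁺), given Gross–Zagier.  CONDITIONAL.
* §3 **`stub_minimalTwinSupplyAtTwoPos_of_analyticKernel`** — the registered stub A⁺ FROM its analytic kernel «for every real-narrow habitat curve
  with `Δ > 0`: an imaginary quadratic `K` with odd `d_K ≠ −3`, Heegner for `N_E`, the two Theorem-B₂ non-squares, every prime of `d_K` silent, and
  `r_an(E^(d_K)) = 1`» (Gross–Zagier–Kolyvagin / BFH territory; NOT proved here).

HONEST FRAMING: descent bookkeeping over tree theorems; the analytic kernel is exactly as hard as before.  Beyond print: no.  BSD is NOT proved.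

References: [MazurRubin2010] Prop. 3.3, Cor. 3.4 (i); [Kramer1981] §2 Prop. 3, Thm. 1; [SilvermanAEC2009] VIII.8 Cor. 8.3, App. C §16.
-/

set_option linter.dupNamespace false -- tree convention: `Summit.BirchSwinnertonDyer.BirchSwinnertonDyer.Theorems` (summit = sub-problem)
set_option autoImplicit false

noncomputable section

open scoped Classical

namespace Summit.BirchSwinnertonDyer.BirchSwinnertonDyer.Theorems.GenusExact.PlusDescent

open WeierstrassCurve Field NumberField IsDedekindDomain
open Literature.NumberTheory.EllipticCurves Literature.NumberTheory.GaloisRepresentations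
open Literature.NumberTheory.EllipticCurves.ModularForms

variable (W : WeierstrassCurve ℚ) [W.IsElliptic] [W.IsGloballyMinimal]

/-! ## §1 The real-narrow clause ⟹ the Tamagawa-odd Heegner twin is `2`-Selmer-minimal -/

/-- **Real-narrow ⟹ `#Sel₂(Wd) = 2` for every Tamagawa-odd Heegner twin on `Δ > 0`, UNCONDITIONALLY.**  `W/ℚ` globally minimal elliptic,
`Δ_W > 0`, `C(W)` odd, and `#Sel₂(W) = 1 ∨ (#Sel₂(W) = 4 ∧ ∃ c ∈ Sel₂(W), loc_∞ c ≠ 0)` (the clause of `GenusPrimitiveSupplyAtTwoPosDiscShallow`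
verbatim); `K` imaginary quadratic with odd `d_K`, Heegner for `N_W`; `Wd ≅ W^(d_K)` elliptic with `ord₂ C(Wd) = 0`.  Then `#Sel₂(Wd) = 2`
(LEAD's `…_of_natCard_selmerGroup_eq_one` in the first case, the LOWERING half of the shift law in the second).
[cite: MazurRubin2010, Prop. 3.3, Cor. 3.4 (i)] [cite: Kramer1981, Thm. 1] -/
theorem natCard_selmerGroup_twin_eq_two_of_realNarrow_of_padicValNat_eq_zero {K : Type} [Field K] [NumberField K]
    (hΔ : 0 < W.Δ) (hTam : Odd W.tamagawaProduct)
    (hnarrow : Nat.card (W.selmerGroup 2) = 1 ∨ (Nat.card (W.selmerGroup 2) = 4 ∧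
      ∃ c ∈ (W.kummerSelmerStructure ((2 : ℕ) : ℤ)).selmerGroup,
        galoisCohomology.localization (W.torsionGaloisModule ((2 : ℕ) : ℤ)) (Sum.inl Rat.infinitePlace) 1 c ≠ 0))
    (hK : IsImaginaryQuadratic K) (hodd : Odd (discr K)) (hH : SatisfiesHeegnerHypothesis (W.conductorNorm ℤ) K)
    (Wd : WeierstrassCurve ℚ) [Wd.IsElliptic] (hWd : ∃ C : VariableChange ℚ, C • W.quadraticTwist (discr K : ℚ) = Wd)
    (hDEF : padicValNat 2 Wd.tamagawaProduct = 0) :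
    Nat.card (Wd.selmerGroup 2) = 2 := by
  rcases hnarrow with h1 | ⟨h4, hns⟩
  · exact natCard_selmerGroup_twin_eq_two_of_posDisc_of_natCard_selmerGroup_eq_one W hΔ hTam hK hodd hH Wd hWd hDEF h1
  · have h := (natCard_selmerGroup_twin_eq_mul_two_or_of_posDisc_of_padicValNat_eq_zero W hΔ hTam hK hodd hH Wd hWd hDEF).2 hns
    simp only [Nat.cast_ofNat] at h
    rw [h4] at h
    omega

/-- **The same in the all-silent currency**: `W/ℚ` globally minimal elliptic, `Δ_W > 0`, `C(W)` odd, real-narrow; `K` imaginary quadratic with odd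
`d_K`, Heegner for `N_W`, EVERY prime of `d_K` silent (`W(ℚ_q)[2] = 0`); `Wd ≅ W^(d_K)` elliptic.  Then `ord₂ C(Wd) = 0 ∧ #Sel₂(Wd) = 2`.
[cite: Kramer1981, §2 Prop. 3, Thm. 1] [cite: MazurRubin2010, Cor. 3.4 (i)] -/
theorem twin_padicValNat_eq_zero_and_natCard_selmerGroup_eq_two_of_realNarrow_of_forall_silent {K : Type} [Field K] [NumberField K]
    (hΔ : 0 < W.Δ) (hTam : Odd W.tamagawaProduct)
    (hnarrow : Nat.card (W.selmerGroup 2) = 1 ∨ (Nat.card (W.selmerGroup 2) = 4 ∧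
      ∃ c ∈ (W.kummerSelmerStructure ((2 : ℕ) : ℤ)).selmerGroup,
        galoisCohomology.localization (W.torsionGaloisModule ((2 : ℕ) : ℤ)) (Sum.inl Rat.infinitePlace) 1 c ≠ 0))
    (hK : IsImaginaryQuadratic K) (hodd : Odd (discr K)) (hH : SatisfiesHeegnerHypothesis (W.conductorNorm ℤ) K)
    (hsil : ∀ (p : ℕ) [Fact p.Prime], (p : ℤ) ∣ discr K → ∀ Q : (W.baseChange ℚ_[p]).toAffine.Point, 2 • Q = 0 → Q = 0)
    (Wd : WeierstrassCurve ℚ) [Wd.IsElliptic] (hWd : ∃ C : VariableChange ℚ, C • W.quadraticTwist (discr K : ℚ) = Wd) :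
    padicValNat 2 Wd.tamagawaProduct = 0 ∧ Nat.card (Wd.selmerGroup 2) = 2 := by
  obtain ⟨Cd, hCd⟩ := hWd
  have hDEF := padicValNat_two_tamagawaProduct_twin_eq_zero_of_forall_silent W hK hodd hH hTam Cd hCd hsil
  exact ⟨hDEF, natCard_selmerGroup_twin_eq_two_of_realNarrow_of_padicValNat_eq_zero W hΔ hTam hnarrow hK hodd hH Wd ⟨Cd, hCd⟩ hDEF⟩

/-! ## §2 The twin block of stub A⁺ from an all-silent Heegner field with `r_an(W^(d_K)) = 1` -/

/-- **The twin block of `stub_minimalTwinSupplyAtTwoPos`**, from the real-narrow clause, an all-silent Heegner field and `r_an(W^(d_K)) = 1`: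
a GLOBALLY MINIMAL model `Wd ≅ W^(d_K)` with `r_an(Wd) = 1`, `#Sel₂(Wd) = 2`, `ord₂ C(Wd) = 0` (global minimal models over `ℚ`; the analytic rank is
an isomorphism invariant).  [cite: SilvermanAEC2009, VIII.8 Cor. 8.3, App. C §16] [cite: MazurRubin2010, Cor. 3.4 (i)] [cite: Kramer1981, Thm. 1] -/
theorem exists_isGloballyMinimal_twin_of_realNarrow_of_forall_silent {K : Type} [Field K] [NumberField K]
    (hΔ : 0 < W.Δ) (hTam : Odd W.tamagawaProduct)
    (hnarrow : Nat.card (W.selmerGroup 2) = 1 ∨ (Nat.card (W.selmerGroup 2) = 4 ∧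
      ∃ c ∈ (W.kummerSelmerStructure ((2 : ℕ) : ℤ)).selmerGroup,
        galoisCohomology.localization (W.torsionGaloisModule ((2 : ℕ) : ℤ)) (Sum.inl Rat.infinitePlace) 1 c ≠ 0))
    (hK : IsImaginaryQuadratic K) (hodd : Odd (discr K)) (hH : SatisfiesHeegnerHypothesis (W.conductorNorm ℤ) K)
    (hsil : ∀ (p : ℕ) [Fact p.Prime], (p : ℤ) ∣ discr K → ∀ Q : (W.baseChange ℚ_[p]).toAffine.Point, 2 • Q = 0 → Q = 0)
    (hran : haveI := W.isElliptic_quadraticTwist (show (discr K : ℚ) ≠ 0 by exact_mod_cast NumberField.discr_ne_zero K)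
      (W.quadraticTwist (discr K : ℚ)).analyticRank = 1) :
    ∃ (Wd : WeierstrassCurve ℚ) (_ : Wd.IsElliptic) (_ : Wd.IsGloballyMinimal),
      (∃ C : VariableChange ℚ, C • W.quadraticTwist (discr K : ℚ) = Wd) ∧ Wd.analyticRank = 1 ∧ Nat.card (Wd.selmerGroup 2) = 2 ∧
        padicValNat 2 Wd.tamagawaProduct = 0 := by
  have hd0 : (discr K : ℚ) ≠ 0 := by exact_mod_cast NumberField.discr_ne_zero K
  haveI hT := W.isElliptic_quadraticTwist hd0
  obtain ⟨C, hC⟩ := hasGlobalMinimalModel_rat_holds (W.quadraticTwist (discr K : ℚ))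
  refine ⟨C • W.quadraticTwist (discr K : ℚ), inferInstance, hC, ⟨C, rfl⟩, ?_, ?_⟩
  · rw [analyticRank_smul]
    exact hran
  · obtain ⟨hDEF, hSel⟩ := twin_padicValNat_eq_zero_and_natCard_selmerGroup_eq_two_of_realNarrow_of_forall_silent W hΔ hTam hnarrow hK
      hodd hH hsil (C • W.quadraticTwist (discr K : ℚ)) ⟨C, rfl⟩
    exact ⟨hSel, hDEF⟩

/-! ## §3 Stub A⁺ of «genus_supply_pos_shallow» from its analytic kernel -/

omit [W.IsElliptic] [W.IsGloballyMinimal] in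
/-- **`stub_minimalTwinSupplyAtTwoPos` (LEAD skeleton «genus_supply_pos_shallow» on stmt-BirchSwinnertonDyer-25504) FROM ITS ANALYTIC KERNEL.**
Displayed hypothesis `hA`: for every habitat curve (non-CM, `r_an = 0`, `ρ_{E,2^n}` onto, odd Tamagawa) with `Δ > 0` and the real-narrow clause, an
imaginary quadratic `K` with odd `d_K ≠ −3`, Heegner for `N_E`, the two Theorem-B₂ non-squares, EVERY prime of `d_K` silent, and `r_an(E^(d_K)) = 1`.
Conclusion: the registered signature of stub A⁺ verbatim (the `K` of `hA` and a globally minimal model of `E^(d_K)`, §2).  The kernel is the honest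
open content of A⁺ (a non-vanishing / Gross–Zagier–Kolyvagin statement over a Čebotarev class of silent Heegner fields); it is NOT proved here.
[cite: MazurRubin2010, Cor. 3.4 (i)] [cite: Kramer1981, Thm. 1] [cite: SilvermanAEC2009, VIII.8 Cor. 8.3] -/
theorem stub_minimalTwinSupplyAtTwoPos_of_analyticKernel
    (hA : ∀ (W : WeierstrassCurve ℚ) [W.IsElliptic] [W.IsGloballyMinimal] [NeZero (W.conductorNorm ℤ)], ¬ W.HasCM → W.analyticRank = 0 →
      (∀ n : ℕ, 0 < n → W.HasSurjectiveModNGaloisRep ((2 : ℤ) ^ n)) → Odd W.tamagawaProduct → 0 < W.Δ →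
      (Nat.card (W.selmerGroup 2) = 1 ∨ (Nat.card (W.selmerGroup 2) = 4 ∧
        ∃ c ∈ (W.kummerSelmerStructure ((2 : ℕ) : ℤ)).selmerGroup,
          galoisCohomology.localization (W.torsionGaloisModule ((2 : ℕ) : ℤ)) (Sum.inl Rat.infinitePlace) 1 c ≠ 0)) →
      ∃ (K : Type) (_ : Field K) (_ : NumberField K), IsImaginaryQuadratic K ∧ Odd (NumberField.discr K) ∧ NumberField.discr K ≠ -3 ∧
        SatisfiesHeegnerHypothesis (W.conductorNorm ℤ) K ∧ ¬ IsSquare ((NumberField.discr K : ℚ) * -|W.Δ|) ∧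
        ¬ IsSquare ((NumberField.discr K : ℚ) * (-(2 * |W.Δ|))) ∧
        (∀ (p : ℕ) [Fact p.Prime], (p : ℤ) ∣ NumberField.discr K → ∀ Q : (W.baseChange ℚ_[p]).toAffine.Point, 2 • Q = 0 → Q = 0) ∧
        (∀ [(W.quadraticTwist (NumberField.discr K : ℚ)).IsElliptic], (W.quadraticTwist (NumberField.discr K : ℚ)).analyticRank = 1)) :
    ∀ (W : WeierstrassCurve ℚ) [W.IsElliptic] [W.IsGloballyMinimal] [NeZero (W.conductorNorm ℤ)], ¬ W.HasCM → W.analyticRank = 0 →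
      (∀ n : ℕ, 0 < n → W.HasSurjectiveModNGaloisRep ((2 : ℤ) ^ n)) → Odd W.tamagawaProduct → 0 < W.Δ →
      (Nat.card (W.selmerGroup 2) = 1 ∨ (Nat.card (W.selmerGroup 2) = 4 ∧
        ∃ c ∈ (W.kummerSelmerStructure ((2 : ℕ) : ℤ)).selmerGroup,
          Literature.NumberTheory.GaloisRepresentations.galoisCohomology.localization (W.torsionGaloisModule ((2 : ℕ) : ℤ))
            (Sum.inl Rat.infinitePlace) 1 c ≠ 0)) →
      ∃ (K : Type) (_ : Field K) (_ : NumberField K), IsImaginaryQuadratic K ∧ Odd (NumberField.discr K) ∧ NumberField.discr K ≠ -3 ∧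
        SatisfiesHeegnerHypothesis (W.conductorNorm ℤ) K ∧ ¬ IsSquare ((NumberField.discr K : ℚ) * -|W.Δ|) ∧
        ¬ IsSquare ((NumberField.discr K : ℚ) * (-(2 * |W.Δ|))) ∧
        ∃ (Wd : WeierstrassCurve ℚ) (_ : Wd.IsElliptic) (_ : Wd.IsGloballyMinimal),
          (∃ C : WeierstrassCurve.VariableChange ℚ, C • W.quadraticTwist (NumberField.discr K : ℚ) = Wd) ∧ Wd.analyticRank = 1 ∧
            Nat.card (Wd.selmerGroup 2) = 2 ∧ padicValNat 2 Wd.tamagawaProduct = 0 := by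
  intro W _ _ _ hcm hr0 hρ hT hΔ hnarrow
  obtain ⟨K, _, _, hIQ, hodd, h3, hHe, hsq1, hsq2, hsil, hran⟩ := hA W hcm hr0 hρ hT hΔ hnarrow
  have hd0 : (discr K : ℚ) ≠ 0 := by exact_mod_cast NumberField.discr_ne_zero K
  haveI hTell := W.isElliptic_quadraticTwist hd0
  obtain ⟨Wd, _, _, hWd, hr1, hSel, hDEF⟩ :=
    exists_isGloballyMinimal_twin_of_realNarrow_of_forall_silent W hΔ hT hnarrow hIQ hodd hHe hsil hran
  exact ⟨K, inferInstance, inferInstance, hIQ, hodd, h3, hHe, hsq1, hsq2, Wd, inferInstance, inferInstance, hWd, hr1, hSel, hDEF⟩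

/-! ## §4 The Heegner field is FREE: silent prime Heegner fields (gk2-p5's Čebotarev supply) and the prime kernel -/

/-- **Everything of stub A⁺ except `r_an(Wd) = 1`, UNCONDITIONALLY and beyond every bound.**  `W/ℚ` globally minimal elliptic with `Δ_W > 0`,
`C(W)` odd, `ρ̄_{W,2}` onto and the real-narrow clause; then for every `b` there are a prime `ℓ > b` and an imaginary quadratic `K` with
`d_K = −ℓ` odd `≠ −3`, Heegner for `N_W`, the two Theorem-B₂ non-squares, EVERY prime of `d_K` silent for `W`, such that EVERY elliptic model
`Wd ≅ W^(d_K)` has `ord₂ C(Wd) = 0 ∧ #Sel₂(Wd) = 2` (gk2-p5's `GenusKolyTwin.exists_silent_prime_heegnerField` ∘ §1).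
[cite: SerreAbelianLadic1968, Ch. I §2.2, Cor. 2 (a)] [cite: MazurRubin2010, Cor. 3.4 (i)] [cite: Kramer1981, §2 Prop. 3, Thm. 1] -/
theorem exists_allSilent_heegnerField_twin_of_realNarrow (hΔ : 0 < W.Δ) (hTam : Odd W.tamagawaProduct)
    (hsurj : W.HasSurjectiveModNGaloisRep 2)
    (hnarrow : Nat.card (W.selmerGroup 2) = 1 ∨ (Nat.card (W.selmerGroup 2) = 4 ∧
      ∃ c ∈ (W.kummerSelmerStructure ((2 : ℕ) : ℤ)).selmerGroup,
        galoisCohomology.localization (W.torsionGaloisModule ((2 : ℕ) : ℤ)) (Sum.inl Rat.infinitePlace) 1 c ≠ 0))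
    (b : ℕ) :
    ∃ (ℓ : ℕ) (K : Type) (_ : Field K) (_ : NumberField K), b < ℓ ∧ ℓ.Prime ∧ IsImaginaryQuadratic K ∧ discr K = -(ℓ : ℤ) ∧ Odd (discr K) ∧
      discr K ≠ -3 ∧ SatisfiesHeegnerHypothesis (W.conductorNorm ℤ) K ∧
      ¬ IsSquare ((discr K : ℚ) * -|W.Δ|) ∧ ¬ IsSquare ((discr K : ℚ) * (-(2 * |W.Δ|))) ∧
      (∀ (p : ℕ) [Fact p.Prime], (p : ℤ) ∣ discr K → ∀ Q : (W.baseChange ℚ_[p]).toAffine.Point, 2 • Q = 0 → Q = 0) ∧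
      ∀ (Wd : WeierstrassCurve ℚ) [Wd.IsElliptic], (∃ C : VariableChange ℚ, C • W.quadraticTwist (discr K : ℚ) = Wd) →
        padicValNat 2 Wd.tamagawaProduct = 0 ∧ Nat.card (Wd.selmerGroup 2) = 2 := by
  obtain ⟨ℓ, hb, hℓ, hℓ8, hℓN, hsil, -, hsilQ, K, _, _, hIQ, hdK, hodd, h3, hHe, -, hsq1, hsq2⟩ :=
    GenusKolyTwin.exists_silent_prime_heegnerField W hΔ hsurj b
  have hsilAll : ∀ (p : ℕ) [Fact p.Prime], (p : ℤ) ∣ discr K → ∀ Q : (W.baseChange ℚ_[p]).toAffine.Point, 2 • Q = 0 → Q = 0 := by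
    intro p hp hpd
    have hpℓ : p = ℓ := by
      rw [hdK, Int.dvd_neg] at hpd
      exact (Nat.prime_dvd_prime_iff_eq hp.out hℓ).mp (Int.natCast_dvd_natCast.mp hpd)
    subst hpℓ
    exact hsilQ
  exact ⟨ℓ, K, inferInstance, inferInstance, hb, hℓ, hIQ, hdK, hodd, h3, hHe, hsq1, hsq2, hsilAll, fun Wd _ hWd ↦
    twin_padicValNat_eq_zero_and_natCard_selmerGroup_eq_two_of_realNarrow_of_forall_silent W hΔ hTam hnarrow hIQ hodd hHe hsilAll Wd hWd⟩

omit [W.IsElliptic] [W.IsGloballyMinimal] in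
/-- **`stub_minimalTwinSupplyAtTwoPos` FROM ITS PRIME KERNEL.**  Displayed hypothesis `hP`: for every habitat curve with `Δ > 0` and the
real-narrow clause, SOME prime `ℓ ≡ 7 (mod 8)` with `ℓ ≡ −1 (mod p)` for every odd `p ∣ N_E` and no root of the `2`-division cubic mod `ℓ`
(such primes exist beyond every bound, §4) has `r_an(E^(d_K)) = 1` for the (unique) field `K` with `d_K = −ℓ`.  Conclusion: the registered
signature of stub A⁺ verbatim.  The kernel is a non-vanishing statement for `L′(E^(−ℓ), 1)` on a ČEBOTAREV class of primes (not a congruence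
class) — the honest open content; NOT proved here.  [cite: GrossLMS1991, §1] [cite: MazurRubin2010, Cor. 3.4 (i)] [cite: Kramer1981, Thm. 1] -/
theorem stub_minimalTwinSupplyAtTwoPos_of_primeKernel
    (hP : ∀ (W : WeierstrassCurve ℚ) [W.IsElliptic] [W.IsGloballyMinimal] [NeZero (W.conductorNorm ℤ)], ¬ W.HasCM → W.analyticRank = 0 →
      (∀ n : ℕ, 0 < n → W.HasSurjectiveModNGaloisRep ((2 : ℤ) ^ n)) → Odd W.tamagawaProduct → 0 < W.Δ →
      (Nat.card (W.selmerGroup 2) = 1 ∨ (Nat.card (W.selmerGroup 2) = 4 ∧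
        ∃ c ∈ (W.kummerSelmerStructure ((2 : ℕ) : ℤ)).selmerGroup,
          galoisCohomology.localization (W.torsionGaloisModule ((2 : ℕ) : ℤ)) (Sum.inl Rat.infinitePlace) 1 c ≠ 0)) →
      ∃ ℓ : ℕ, ℓ.Prime ∧ ℓ % 8 = 7 ∧ (∀ p : ℕ, p.Prime → p ∣ W.conductorNorm ℤ → p ≠ 2 → (ℓ : ZMod p) = -1) ∧
        (∀ x : ZMod ℓ, 4 * x ^ 3 + ((integralModelInt W).b₂ : ZMod ℓ) * x ^ 2 +
          2 * ((integralModelInt W).b₄ : ZMod ℓ) * x + ((integralModelInt W).b₆ : ZMod ℓ) ≠ 0) ∧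
        ∀ (K : Type) [Field K] [NumberField K], discr K = -(ℓ : ℤ) →
          ∀ [(W.quadraticTwist (discr K : ℚ)).IsElliptic], (W.quadraticTwist (discr K : ℚ)).analyticRank = 1) :
    ∀ (W : WeierstrassCurve ℚ) [W.IsElliptic] [W.IsGloballyMinimal] [NeZero (W.conductorNorm ℤ)], ¬ W.HasCM → W.analyticRank = 0 →
      (∀ n : ℕ, 0 < n → W.HasSurjectiveModNGaloisRep ((2 : ℤ) ^ n)) → Odd W.tamagawaProduct → 0 < W.Δ →
      (Nat.card (W.selmerGroup 2) = 1 ∨ (Nat.card (W.selmerGroup 2) = 4 ∧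
        ∃ c ∈ (W.kummerSelmerStructure ((2 : ℕ) : ℤ)).selmerGroup,
          Literature.NumberTheory.GaloisRepresentations.galoisCohomology.localization (W.torsionGaloisModule ((2 : ℕ) : ℤ))
            (Sum.inl Rat.infinitePlace) 1 c ≠ 0)) →
      ∃ (K : Type) (_ : Field K) (_ : NumberField K), IsImaginaryQuadratic K ∧ Odd (NumberField.discr K) ∧ NumberField.discr K ≠ -3 ∧
        SatisfiesHeegnerHypothesis (W.conductorNorm ℤ) K ∧ ¬ IsSquare ((NumberField.discr K : ℚ) * -|W.Δ|) ∧
        ¬ IsSquare ((NumberField.discr K : ℚ) * (-(2 * |W.Δ|))) ∧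
        ∃ (Wd : WeierstrassCurve ℚ) (_ : Wd.IsElliptic) (_ : Wd.IsGloballyMinimal),
          (∃ C : WeierstrassCurve.VariableChange ℚ, C • W.quadraticTwist (NumberField.discr K : ℚ) = Wd) ∧ Wd.analyticRank = 1 ∧
            Nat.card (Wd.selmerGroup 2) = 2 ∧ padicValNat 2 Wd.tamagawaProduct = 0 := by
  refine stub_minimalTwinSupplyAtTwoPos_of_analyticKernel fun W _ _ _ hcm hr0 hρ hT hΔ hnarrow ↦ ?_
  obtain ⟨ℓ, hℓ, hℓ8, hℓN, hsil, hran⟩ := hP W hcm hr0 hρ hT hΔ hnarrow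
  obtain ⟨-, hsilQ, K, _, _, hIQ, hdK, hodd, h3, hHe, -, hsq1, hsq2⟩ := GenusKolyTwin.exists_silent_heegnerField_of_prime W hℓ hℓ8 hℓN hsil
  have hsilAll : ∀ (p : ℕ) [Fact p.Prime], (p : ℤ) ∣ discr K → ∀ Q : (W.baseChange ℚ_[p]).toAffine.Point, 2 • Q = 0 → Q = 0 := by
    intro p hp hpd
    have hpℓ : p = ℓ := by
      rw [hdK, Int.dvd_neg] at hpd
      exact (Nat.prime_dvd_prime_iff_eq hp.out hℓ).mp (Int.natCast_dvd_natCast.mp hpd)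
    subst hpℓ
    exact hsilQ
  exact ⟨K, inferInstance, inferInstance, hIQ, hodd, h3, hHe, hsq1, hsq2, hsilAll, hran K hdK⟩

open Summit.BirchSwinnertonDyer.BirchSwinnertonDyer.Theorems.GenusKoly (stub_heegnerNonTorsionAtTwo_of_grossZagier
  exists_exactTwoDivisibility_of_not_isOfFinAddOrder twin_not_hasCM)

/-! ## §5 The crux BY NAME from its two open kernels, modulo Gross–Zagier -/

/-- **THE `Δ > 0` SUPPLY CRUX `GenusPrimitiveSupplyAtTwoPosDiscShallow` BY NAME FROM ITS TWO OPEN KERNELS, modulo Gross–Zagier.**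
Displayed: `hGZ` — the Gross–Zagier formula (named fact `gross_zagier`, every pair `(E, K)`); `hP` — the PRIME KERNEL of stub A⁺ («for every
real-narrow habitat curve with `Δ > 0`, some prime `ℓ ≡ 7 (mod 8)`, `ℓ ≡ −1 (mod p)` for all odd `p ∣ N_E`, with the `2`-division cubic rootless
mod `ℓ`, has `r_an(E^(d_K)) = 1` for the field `K` with `d_K = −ℓ`»); `hC` — stub C⁺ of «genus_supply_pos_shallow» verbatim (a `2`-primitive derived
point at transposition-deep Kolyvagin primes).  Everything else — the silent prime Heegner field, the Tamagawa-odd `2`-Selmer-minimal globally minimal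
twin, `y_K` of infinite order (Gross–Zagier), `M₀`, the orientation and the conductor-`1` datum, non-CM of the twin — is a theorem of the tree.
CONDITIONAL on the three displayed hypotheses; the crux is NOT proved.  [cite: GrossZagier1986, Thm. I.6.3] [cite: GrossLMS1991, §1 (p. 235), §3]
[cite: MazurRubin2010, Cor. 3.4 (i)] [cite: Kramer1981, Thm. 1] [cite: McCallumLMS1991, §5 Lemma 5.1 proof] -/
theorem genusPrimitiveSupplyAtTwoPosDiscShallow_of_kernels
    (hGZ : ∀ (W : WeierstrassCurve ℚ) [NeZero (W.conductorNorm ℤ)] (K : Type) [Field K] [NumberField K],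
      gross_zagier (W.conductorNorm ℤ) W K)
    (hP : ∀ (W : WeierstrassCurve ℚ) [W.IsElliptic] [W.IsGloballyMinimal] [NeZero (W.conductorNorm ℤ)], ¬ W.HasCM → W.analyticRank = 0 →
      (∀ n : ℕ, 0 < n → W.HasSurjectiveModNGaloisRep ((2 : ℤ) ^ n)) → Odd W.tamagawaProduct → 0 < W.Δ →
      (Nat.card (W.selmerGroup 2) = 1 ∨ (Nat.card (W.selmerGroup 2) = 4 ∧
        ∃ c ∈ (W.kummerSelmerStructure ((2 : ℕ) : ℤ)).selmerGroup,
          galoisCohomology.localization (W.torsionGaloisModule ((2 : ℕ) : ℤ)) (Sum.inl Rat.infinitePlace) 1 c ≠ 0)) →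
      ∃ ℓ : ℕ, ℓ.Prime ∧ ℓ % 8 = 7 ∧ (∀ p : ℕ, p.Prime → p ∣ W.conductorNorm ℤ → p ≠ 2 → (ℓ : ZMod p) = -1) ∧
        (∀ x : ZMod ℓ, 4 * x ^ 3 + ((integralModelInt W).b₂ : ZMod ℓ) * x ^ 2 +
          2 * ((integralModelInt W).b₄ : ZMod ℓ) * x + ((integralModelInt W).b₆ : ZMod ℓ) ≠ 0) ∧
        ∀ (K : Type) [Field K] [NumberField K], discr K = -(ℓ : ℤ) →
          ∀ [(W.quadraticTwist (discr K : ℚ)).IsElliptic], (W.quadraticTwist (discr K : ℚ)).analyticRank = 1)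
    (hC : ∀ (W : WeierstrassCurve ℚ) [W.IsElliptic] [W.IsGloballyMinimal] [NeZero (W.conductorNorm ℤ)], ¬ W.HasCM → W.analyticRank = 0 →
      (∀ n : ℕ, 0 < n → W.HasSurjectiveModNGaloisRep ((2 : ℤ) ^ n)) → Odd W.tamagawaProduct → 0 < W.Δ →
      ∀ (K : Type) [Field K] [NumberField K], IsImaginaryQuadratic K → Odd (NumberField.discr K) → NumberField.discr K ≠ -3 →
      SatisfiesHeegnerHypothesis (W.conductorNorm ℤ) K → ¬ IsSquare ((NumberField.discr K : ℚ) * -|W.Δ|) →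
      ¬ IsSquare ((NumberField.discr K : ℚ) * (-(2 * |W.Δ|))) →
      ∀ (Dt : ModularParametrizationData W (W.conductorNorm ℤ)), (∀ z ∈ Dt.L.lattice, ∃ w ∈ periodLattice Dt.f, z = (Dt.c : ℂ) * w) →
      Odd Dt.c → ∀ (β : ℤ) (ι : K →+* ℂ) (d₁ : KolyvaginHeegnerData Dt β ι 1), ¬ IsOfFinAddOrder d₁.derivedPoint →
      ∀ (Wd : WeierstrassCurve ℚ) [Wd.IsElliptic] [Wd.IsGloballyMinimal],
      (∃ C : WeierstrassCurve.VariableChange ℚ, C • W.quadraticTwist (NumberField.discr K : ℚ) = Wd) → Wd.analyticRank = 1 →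
      Nat.card (Wd.selmerGroup 2) = 2 → padicValNat 2 Wd.tamagawaProduct = 0 →
      ∃ (n : ℕ) (d : KolyvaginHeegnerData Dt β ι n), Squarefree n ∧
        (∀ ℓ ∈ n.primeFactors, Zhang2014.IsKolyvaginPrime (W.conductorNorm ℤ) W K 2 ℓ ∧ 2 ≤ Zhang2014.kolyvaginIndex W 2 ℓ ∧
          ∃ (v : IsDedekindDomain.HeightOneSpectrum (𝓞 ℚ)) (𝔓 : Ideal (absIntegers (𝓞 ℚ) ℚ)) (h : Field.absoluteGaloisGroup ℚ),
            ((ℓ : ℕ) : 𝓞 ℚ) ∈ v.asIdeal ∧ 𝔓 ∈ v.primesAbove ∧ IsArithFrobAt (𝓞 ℚ) h 𝔓 ∧ ∃ u : W.geomTorsion ((2 : ℕ) : ℤ), h • u ≠ u) ∧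
        ¬ ∃ Q : (W.baseChange (ringClassField K ι n)).toAffine.Point, (2 : ℤ) • Q = d.derivedPoint) :
    Summit.BirchSwinnertonDyer.BirchSwinnertonDyer.Theses.GenusKolyvaginAtTwo.GenusPrimitiveSupplyAtTwoPosDiscShallow := by
  unfold Summit.BirchSwinnertonDyer.BirchSwinnertonDyer.Theses.GenusKolyvaginAtTwo.GenusPrimitiveSupplyAtTwoPosDiscShallow
  intro W _ _ _ hcm hr0 hρ hT hpos hopt h14
  -- A⁺ = prime kernel + the tree
  obtain ⟨K, iF, iN, hIQ, hodd, h3, hHe, hsq1, hsq2, Wd, iE, iM, hWd, hrd, hSel, hDEF⟩ :=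
    stub_minimalTwinSupplyAtTwoPos_of_primeKernel hP W hcm hr0 hρ hT hpos h14
  obtain ⟨Dt, hoptDt, hc⟩ := hopt
  -- glue: orientation, embedding, conductor-`1` datum
  obtain ⟨β, hβ⟩ : ∃ β : ℤ, (4 * (W.conductorNorm ℤ : ℕ) : ℤ) ∣ β ^ 2 - NumberField.discr K :=
    Literature.NumberTheory.QuadraticFields.Quadratic.exists_dvd_sq_sub_discr_of_ncard_primesOver hIQ.1 (NeZero.ne _) hHe
  obtain ⟨ι⟩ : Nonempty (K →+* ℂ) := inferInstance
  obtain ⟨d₁⟩ := exists_kolyvaginHeegnerData_one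
    (phi_heegnerTau_mem_singularModuliField_holds (W.conductorNorm ℤ) W K) hIQ Dt β ι hβ
  -- the twin: non-CM; the analytic rank of the twist read off the minimal model
  have hd : (NumberField.discr K : ℚ) ≠ 0 := by exact_mod_cast NumberField.discr_ne_zero K
  haveI := W.isElliptic_quadraticTwist hd
  have hcmd : ¬ Wd.HasCM := twin_not_hasCM W hcm hd Wd hWd
  have hrtw : (W.quadraticTwist (NumberField.discr K : ℚ)).analyticRank = 1 := by
    obtain ⟨C, hC⟩ := hWd
    rw [← analyticRank_smul (W.quadraticTwist (NumberField.discr K : ℚ)) C, hC]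
    exact hrd
  -- B = Gross–Zagier
  have hy : ¬ IsOfFinAddOrder d₁.derivedPoint := stub_heegnerNonTorsionAtTwo_of_grossZagier hGZ W K hIQ hHe hr0 hrtw Dt β ι d₁
  obtain ⟨M₀, hdiv, hndiv⟩ := exists_exactTwoDivisibility_of_not_isOfFinAddOrder W hIQ Dt β ι d₁ hy
  -- C⁺ displayed
  obtain ⟨n, d, hn, hKoly, hPn⟩ := hC W hcm hr0 hρ hT hpos K hIQ hodd h3 hHe hsq1 hsq2 Dt hoptDt hc β ι d₁ hy Wd hWd hrd hSel hDEF
  exact ⟨K, iF, iN, hIQ, hodd, h3, hHe, hsq1, hsq2, Dt, β, ι, d₁, hoptDt, hc, hy, M₀, hdiv, hndiv, n, d, hn, hKoly, hPn,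
    Wd, iE, iM, hWd, hcmd, hrd, hSel, hDEF⟩

end Summit.BirchSwinnertonDyer.BirchSwinnertonDyer.Theorems.GenusExact.PlusDescent

end
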